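import Summits.BirchSwinnertonDyer.BirchSwinnertonDyer.Theorems.ByReductionTypeAtTwoMultTowerSplitTowerAlgebra
import Summits.BirchSwinnertonDyer.BirchSwinnertonDyer.Theorems.ByReductionTypeAtTwoMultTowerNS2LocalLayerField
import Summits.BirchSwinnertonDyer.BirchSwinnertonDyer.Theorems.ByReductionTypeAtTwoMultTowerNS2LocalLayerIndex
import Literature.NumberTheory.GaloisRepresentations.LocalNormIndex
import Mathlib.RingTheory.Norm.Transitivity
import HarnessLib

/-!
# Route `ByReductionTypeAtTwo`, crux `MultUpperHalfAtTwo` (item stmt-BirchSwinnertonDyer-19922), TOWER road, SPLIT rows: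
# the EXACT order of the local tower kernel at a split multiplicative prime, part 2 (any prime `p`) — the NORM TRANSFER
# `q ∈ N(F_{m+w}/F_m) ⟸ q^{p^m} ∈ N(F_{m+w}/ℚ_v)` for the cyclic layers of the local cyclotomic `ℤ_p`-tower

HONEST FRAMING (cell `bsd-2adic`, run/shared/lean/pub/bsd-2adic/, seat `bsd-2adic-tower-1` GEN 27, HUMAN RULINGS
D-0036 / D-0054 / D-0074): TOOL theorems only (no definition, no named fact, no `sorry`); closes nothing by itself;
nothing booked; BSD is not proved by any of this. Second module of the LOWER half of the PRINT binder
`hSP = Greenberg1999.sec3_natCard_localTowerKerPrimary_splitMultiplicative_rat` (Greenberg, LNM 1716, §3 pp. 92–93).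
Part 1 (`…MultTowerSplitExactLower.lean`) turns an element `x ∈ F_{m+w}` with relative norm
`N_{F_{m+w}/F_m}(x) = ∏_{i<p^w} g^i x = q_E` into `p^w ≤ #𝒦_{v,m}[p^∞]`; this file PRODUCES such an `x` from the
hypothesis `q_E^{p^m} ∈ N(F_{m+w}/ℚ_v)` — a statement about the norm group of ONE layer over the BASE `ℚ_v`, which is
where the reduction type enters (part 3: at `p = 2` by BRICK 14 `MultTowerNS2.mem_range_norm_fixedField_layer_iff`,
`N(F_mˣ) = ⟨2⟩·±(1 + 2^{m+2}ℤ₂)`).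

Setting (any prime `p`): `κ` the cyclotomic `ℤ_p`-extension, `v ∋ p`, `K = ℚ_v`, `Γ = Gal(K̄/K)`, `H_m` the local layer
subgroups, `F_m = K̄^{H_m}` (Galois over `K`, cyclic of degree `p^m`), `g ∈ H_m` with `κ(res g) = p^m u_g`.

* `isGalois_fixedField_of_isOpen_of_normal`, `isCyclic_gal_fixedField_layer`, `index_range_norm_fixedField_layer` — the
  `p`-general forms of GEN 9's BRICK 14 preliminaries (`…MultTowerNS2LayerNormGroup.lean`, stated there for `p = 2`): `F_m/ℚ_v` is
  Galois, cyclic, and `[ℚ_vˣ : N(F_mˣ)] = p^m` (the tree's PROVED class field axiom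
  `normIndex_eq_finrank_of_isNonarchimedeanLocalField`, Neukirch V (1.1));
* `fixedField_layer_le` — `F_m ≤ F_{m+w}`;
* `exists_prod_smul_eq_of_pow_mem_range_norm` — **if `q^{p^m} ∈ N(F_{m+w}ˣ)` (norm to `ℚ_v`) then some
  `x ∈ K̄ˣ` fixed by `H_{m+w}` has `∏_{i<p^w} g^i x = q`** — the input `hxw`/`hNx` of part 1. Inside: (relative orbit
  product = relative norm) `N_{F_{m+w}/F_m}(z) = ∏_{i<p^w} g^i z` in `K̄`, since `Gal(F_{m+w}/F_m) = {g^i|}_{i<p^w}`;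
  (the transfer by COUNTING) the kernel of `N_{F_m/ℚ_v}` on `F_mˣ` lies in `N(F_{m+w}/F_m)` — from `Subgroup.index_map`
  and the three class-field indices `p^m`, `p^{m+w}`, `p^w` (`[F_mˣ : N(F_{m+w}/F_m)] = p^w`, the axiom for the cyclic layer
  `F_{m+w}/F_m` of the local field `F_m`, `normIndex_eq_finrank_of_isNonarchimedeanLocalField ℚ_v F_m F_{m+w}`).

References: R. Greenberg, LNM 1716 (1999), §3 pp. 85–93; J. Neukirch, *ANT* IV §1, V §1 Thm. (1.1);
L. Washington, *Introduction to Cyclotomic Fields*, §13.1; cell memo SCOPE-hNS2one-kernel-GEN8.md S5 (the counting transfer).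
-/

set_option autoImplicit false
-- the Theorems namespace of this sub repeats the summit name by design (D-0017 nested layout: Summit.<S>.<Sub>)
set_option linter.dupNamespace false

noncomputable section

open scoped Classical IntermediateField

namespace Summit.BirchSwinnertonDyer.BirchSwinnertonDyer.Theorems.MultTowerSplitExact

open NumberField IsDedekindDomain Field PadicInt Rat.HeightOneSpectrum
  Literature.NumberTheory.EllipticCurves Literature.NumberTheory.GaloisRepresentations
  Summit.BirchSwinnertonDyer.BirchSwinnertonDyer.Theorems.MultTowerNS2

variable {p : ℕ} [hp : Fact p.Prime] {κ : ZpExtension ℚ p}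

/-! ### `F_m / ℚ_v` is Galois, cyclic, with norm index `p^m` (any `p`) -/

/-- **`K̄^H/ℚ_v` is Galois for an OPEN NORMAL subgroup `H ≤ Γ_{ℚ_v}`** (Krull: the fixing subgroup of `K̄^H` is `H`
itself, and normality of the subgroup is normality of the extension). Applied below to the local layer subgroups `H_m`
at any prime `p` (GEN 9's `MultTowerNS2.isGalois_fixedField_localSubgroup_layerSubgroup` is the case `H = H_m`, `p = 2`).
[cite: Washington1997, §13.1] [cite: NeukirchANT1999, Ch. IV §1] -/
theorem isGalois_fixedField_of_isOpen_of_normal (v : HeightOneSpectrum (𝓞 ℚ))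
    (H : Subgroup (absoluteGaloisGroup (v.adicCompletion ℚ)))
    (hopen : IsOpen (H : Set (absoluteGaloisGroup (v.adicCompletion ℚ)))) (hnormal : H.Normal) :
    IsGalois (v.adicCompletion ℚ) (IntermediateField.fixedField H) := by
  haveI : CharZero (v.adicCompletion ℚ) :=
    charZero_of_injective_algebraMap (algebraMap ℚ (v.adicCompletion ℚ)).injective
  have hfix := fixingSubgroup_fixedField_of_isOpen _ hopen
  have key := fun x ↦ SetLike.ext_iff.mp hfix x
  refine (InfiniteGalois.normal_iff_isGalois _).mp ?_
  exact ⟨fun a ha b ↦ (key _).mpr (hnormal.conj_mem a ((key a).mp ha) b)⟩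

/-- **`Gal(F_m/ℚ_v)` is cyclic** (any `p`): `Γ_{ℚ_v}/H_m ≅ ℤ_p/p^m ≅ ℤ/p^m` (`κ ∘ res_v` onto) and Krull. The
`p`-general form of `MultTowerNS2.isCyclic_gal_fixedField_localSubgroup_layerSubgroup`. [cite: Washington1997, §13.1] -/
theorem isCyclic_gal_fixedField_layer (hκ : κ.IsCyclotomic) (v : HeightOneSpectrum (𝓞 ℚ))
    (hv : ((p : ℕ) : 𝓞 ℚ) ∈ v.asIdeal) (m : ℕ) :
    IsCyclic (IntermediateField.fixedField (localSubgroup (κ.layerSubgroup m) (v.adicCompletion ℚ)) ≃ₐ[v.adicCompletion ℚ]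
      IntermediateField.fixedField (localSubgroup (κ.layerSubgroup m) (v.adicCompletion ℚ))) := by
  have hopen : IsOpen (localSubgroup (κ.layerSubgroup m) (v.adicCompletion ℚ) :
      Set (absoluteGaloisGroup (v.adicCompletion ℚ))) :=
    isOpen_localSubgroup (κ.layerSubgroup m) (κ.isOpen_layerSubgroup m) (v.adicCompletion ℚ)
  have hnormal : (localSubgroup (κ.layerSubgroup m) (v.adicCompletion ℚ)).Normal := by
    rw [localSubgroup_eq_comap]; exact Subgroup.Normal.comap inferInstance _
  have hclosed := (localSubgroup (κ.layerSubgroup m) (v.adicCompletion ℚ)).isClosed_of_isOpen hopen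
  let φ : absoluteGaloisGroup (v.adicCompletion ℚ) →* Multiplicative (ZMod (p ^ m)) :=
    (AddMonoidHom.toMultiplicative (toZModPow (p := p) m).toAddMonoidHom).comp
      (κ.toContinuousMonoidHom.toMonoidHom.comp (resGal (K := ℚ) (v.adicCompletion ℚ)).toMonoidHom)
  have hφ : Function.Surjective φ := by
    intro c
    obtain ⟨t, ht⟩ := ZMod.ringHom_surjective (toZModPow (p := p) m) c.toAdd
    obtain ⟨σ, hσ⟩ := surjective_kappa_comp_resGal hκ v hv (Multiplicative.ofAdd t)
    refine ⟨σ, ?_⟩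
    change Multiplicative.ofAdd (toZModPow m (Multiplicative.toAdd
      ((κ.toContinuousMonoidHom.toMonoidHom.comp (resGal (K := ℚ) (v.adicCompletion ℚ)).toMonoidHom) σ))) = c
    rw [hσ, toAdd_ofAdd, ht, ofAdd_toAdd]
  have hker : φ.ker = localSubgroup (κ.layerSubgroup m) (v.adicCompletion ℚ) := by
    ext σ
    rw [MonoidHom.mem_ker, mem_localSubgroup_iff, ZpExtension.mem_layerSubgroup, ← Ideal.mem_span_singleton,
      ← ker_toZModPow, RingHom.mem_ker]
    constructor
    · intro h
      exact congrArg Multiplicative.toAdd h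
    · intro h
      exact congrArg Multiplicative.ofAdd h
  let Hc : ClosedSubgroup (AlgebraicClosure (v.adicCompletion ℚ) ≃ₐ[v.adicCompletion ℚ]
      AlgebraicClosure (v.adicCompletion ℚ)) := ⟨localSubgroup (κ.layerSubgroup m) (v.adicCompletion ℚ), hclosed⟩
  haveI hN : Hc.toSubgroup.Normal := hnormal
  haveI hcyc0 : IsCyclic (absoluteGaloisGroup (v.adicCompletion ℚ) ⧸ φ.ker) :=
    isCyclic_of_surjective _ (QuotientGroup.quotientKerEquivOfSurjective φ hφ).symm.surjective
  haveI hC : IsCyclic ((AlgebraicClosure (v.adicCompletion ℚ) ≃ₐ[v.adicCompletion ℚ]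
      AlgebraicClosure (v.adicCompletion ℚ)) ⧸ Hc.toSubgroup) :=
    isCyclic_of_surjective _ (QuotientGroup.quotientMulEquivOfEq hker).surjective
  haveI : CharZero (v.adicCompletion ℚ) :=
    charZero_of_injective_algebraMap (algebraMap ℚ (v.adicCompletion ℚ)).injective
  exact isCyclic_of_surjective _ (InfiniteGalois.normalAutEquivQuotient Hc).surjective

/-- **`[ℚ_vˣ : N(F_mˣ)] = p^m`** (any `p`) — the CLASS FIELD AXIOM (Neukirch V (1.1), PROVED in the tree:
`index_range_norm_eq_finrank_of_isCyclic`) for the cyclic extension `F_m/ℚ_v` of degree `p^m`. The `p`-general form of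
`MultTowerNS2.index_range_norm_fixedField_layer`. [cite: NeukirchANT1999, Ch. V §1 Thm. (1.1)] -/
theorem index_range_norm_fixedField_layer (hκ : κ.IsCyclotomic) (v : HeightOneSpectrum (𝓞 ℚ))
    (hv : ((p : ℕ) : 𝓞 ℚ) ∈ v.asIdeal) (m : ℕ) :
    (Units.map (Algebra.norm (v.adicCompletion ℚ) :
        IntermediateField.fixedField (localSubgroup (κ.layerSubgroup m) (v.adicCompletion ℚ)) →*
          v.adicCompletion ℚ)).range.index = p ^ m := by
  haveI := finiteDimensional_fixedField_localSubgroup_layerSubgroup (κ := κ) v m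
  haveI := isGalois_fixedField_of_isOpen_of_normal v (localSubgroup (κ.layerSubgroup m) (v.adicCompletion ℚ))
    (isOpen_localSubgroup (κ.layerSubgroup m) (κ.isOpen_layerSubgroup m) (v.adicCompletion ℚ))
    (by rw [localSubgroup_eq_comap]; exact Subgroup.Normal.comap inferInstance _)
  haveI := isCyclic_gal_fixedField_layer hκ v hv m
  rw [index_range_norm_eq_finrank_of_isCyclic (v.adicCompletion ℚ), finrank_fixedField_localSubgroup_layerSubgroup hκ v hv m]

/-! ### The relative layer `F_{m+w}/F_m`: orbit product = norm, and the transfer -/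

/-- `F_m ≤ F_{m+w}` (the local layer fields increase). [folklore] -/
theorem fixedField_layer_le (v : HeightOneSpectrum (𝓞 ℚ)) (m w : ℕ) :
    IntermediateField.fixedField (localSubgroup (κ.layerSubgroup m) (v.adicCompletion ℚ)) ≤
      IntermediateField.fixedField (localSubgroup (κ.layerSubgroup (m + w)) (v.adicCompletion ℚ)) := by
  intro x hx
  rw [IntermediateField.mem_fixedField_iff] at hx ⊢
  intro h hh
  exact hx h (Subgroup.comap_mono (κ.layerSubgroup_antitone (Nat.le_add_right m w)) hh)

/-- **The transfer package for the cyclic layer `F_{m+w}/F_m` (any `p`).** For `g ∈ H_m` with `κ(res g) = p^m u_g` and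
`q ∈ ℚ_vˣ` with `q^{p^m} ∈ N(F_{m+w}ˣ)` (norms to `ℚ_v`), there is `x ∈ K̄ˣ` fixed by `H_{m+w}` with
`∏_{i<p^w} g^i x = q`. Proof: in the tower `ℚ_v ⊆ F_m ⊆ F_{m+w}` (intermediate fields of `K̄_v`,
`LocalWeilDatum.towerAlgebra`), `F_{m+w}/F_m` is Galois with group `{g^i|}_{i<p^w}` (restrictions distinct since
`g^i ∈ H_{m+w} ↔ p^w ∣ i`, and `#Gal = [F_{m+w} : F_m] = p^w`), hence cyclic, and
`N_{F_{m+w}/F_m}(z) = ∏_{i<p^w} g^i z`; the class field axiom gives `[F_mˣ : N(F_{m+w}/F_m)] = p^w`, and with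
`[ℚ_vˣ : N F_m] = p^m`, `[ℚ_vˣ : N F_{m+w}] = p^{m+w}` and `N_{F_m} ∘ N_{F_{m+w}/F_m} = N_{F_{m+w}}`, `Subgroup.index_map`
forces `ker N_{F_m/ℚ_v} ≤ N(F_{m+w}/F_m)`; as `N_{F_m/ℚ_v}(q) = q^{p^m} ∈ N(F_{m+w}ˣ) = N_{F_m}(N(F_{m+w}/F_m))`, the element
`q ∈ F_mˣ` differs from a relative norm by an element of that kernel, so `q = N_{F_{m+w}/F_m}(z)`.
[cite: NeukirchANT1999, Ch. IV §1 and Ch. V §1 Thm. (1.1)] [cite: Washington1997, §13.1] -/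
theorem exists_prod_smul_eq_of_pow_mem_range_norm (hκ : κ.IsCyclotomic) (v : HeightOneSpectrum (𝓞 ℚ))
    (hv : ((p : ℕ) : 𝓞 ℚ) ∈ v.asIdeal) (m w : ℕ) {g : absoluteGaloisGroup (v.adicCompletion ℚ)}
    (hgm : g ∈ localSubgroup (κ.layerSubgroup m) (v.adicCompletion ℚ)) {ug : ℤ_[p]ˣ}
    (hug : ((κ (resGal (K := ℚ) (v.adicCompletion ℚ) g)).toAdd : ℤ_[p]) = (p : ℤ_[p]) ^ m * (ug : ℤ_[p]))
    (q : (v.adicCompletion ℚ)ˣ)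
    (hmem : q ^ p ^ m ∈ (Units.map (Algebra.norm (v.adicCompletion ℚ) :
        IntermediateField.fixedField (localSubgroup (κ.layerSubgroup (m + w)) (v.adicCompletion ℚ)) →*
          v.adicCompletion ℚ)).range) :
    ∃ x : (AlgebraicClosure (v.adicCompletion ℚ))ˣ,
      (∀ h ∈ localSubgroup (κ.layerSubgroup (m + w)) (v.adicCompletion ℚ),
        h • (x : AlgebraicClosure (v.adicCompletion ℚ)) = x) ∧
      (∏ i ∈ Finset.range (p ^ w), (g ^ i) • (x : AlgebraicClosure (v.adicCompletion ℚ))) =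
        algebraMap (v.adicCompletion ℚ) (AlgebraicClosure (v.adicCompletion ℚ)) (q : v.adicCompletion ℚ) := by
  -- the groups (built before `CharZero ℚ_v` enters the context, as in BRICK 17)
  set Hm : Subgroup (absoluteGaloisGroup (v.adicCompletion ℚ)) := localSubgroup (κ.layerSubgroup m) (v.adicCompletion ℚ)
    with hHm
  set Hmw : Subgroup (absoluteGaloisGroup (v.adicCompletion ℚ)) :=
    localSubgroup (κ.layerSubgroup (m + w)) (v.adicCompletion ℚ) with hHmw
  have hopen : IsOpen (Hmw : Set (absoluteGaloisGroup (v.adicCompletion ℚ))) :=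
    isOpen_localSubgroup (κ.layerSubgroup (m + w)) (κ.isOpen_layerSubgroup (m + w)) (v.adicCompletion ℚ)
  have hidxK := index_range_norm_fixedField_layer hκ v hv m
  have hidxL := index_range_norm_fixedField_layer hκ v hv (m + w)
  haveI hfinK := finiteDimensional_fixedField_localSubgroup_layerSubgroup (κ := κ) v m
  haveI hfinL := finiteDimensional_fixedField_localSubgroup_layerSubgroup (κ := κ) v (m + w)
  haveI hGalL := isGalois_fixedField_of_isOpen_of_normal v Hmw hopen
    (by rw [hHmw, localSubgroup_eq_comap]; exact Subgroup.Normal.comap inferInstance _)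
  haveI hcycL := isCyclic_gal_fixedField_layer hκ v hv (m + w)
  have hrkK := finrank_fixedField_localSubgroup_layerSubgroup hκ v hv m
  have hrkL := finrank_fixedField_localSubgroup_layerSubgroup hκ v hv (m + w)
  have hpowmem : ∀ i : ℕ, g ^ i ∈ Hmw ↔ p ^ w ∣ i := fun i ↦
    MultTowerSP1.pow_mem_localSubgroup_layerSubgroup_iff (κ := κ) v m w hug i
  have hKL := fixedField_layer_le (κ := κ) v m w
  -- (`CharZero ℚ_v` from here on)
  haveI : CharZero (v.adicCompletion ℚ) :=
    charZero_of_injective_algebraMap (algebraMap ℚ (v.adicCompletion ℚ)).injective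
  set K₀ : IntermediateField (v.adicCompletion ℚ) (AlgebraicClosure (v.adicCompletion ℚ)) :=
    IntermediateField.fixedField Hm with hK₀
  set L₀ : IntermediateField (v.adicCompletion ℚ) (AlgebraicClosure (v.adicCompletion ℚ)) :=
    IntermediateField.fixedField Hmw with hL₀
  have memK : ∀ {x : AlgebraicClosure (v.adicCompletion ℚ)}, x ∈ K₀ ↔ ∀ h ∈ Hm, h • x = x := fun {x} ↦ by
    rw [hK₀, IntermediateField.mem_fixedField_iff]; rfl
  have memL : ∀ {x : AlgebraicClosure (v.adicCompletion ℚ)}, x ∈ L₀ ↔ ∀ h ∈ Hmw, h • x = x := fun {x} ↦ by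
    rw [hL₀, IntermediateField.mem_fixedField_iff]; rfl
  have hfix := fixingSubgroup_fixedField_of_isOpen Hmw hopen
  have keyfix : ∀ σ : absoluteGaloisGroup (v.adicCompletion ℚ), σ ∈ L₀.fixingSubgroup ↔ σ ∈ Hmw := fun σ ↦
    SetLike.ext_iff.mp hfix σ
  -- the tower `ℚ_v ⊆ K₀ ⊆ L₀`
  letI : Algebra K₀ L₀ := LocalWeilDatum.towerAlgebra hKL
  haveI : IsScalarTower (v.adicCompletion ℚ) K₀ L₀ := LocalWeilDatum.towerAlgebra_isScalarTower_bot hKL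
  haveI hfinKL : FiniteDimensional K₀ L₀ := LocalWeilDatum.towerAlgebra_finiteDimensional hKL
  haveI hGal : IsGalois K₀ L₀ := IsGalois.tower_top_of_isGalois (v.adicCompletion ℚ) K₀ L₀
  haveI : Module.Free K₀ L₀ := Module.Free.of_divisionRing K₀ L₀
  haveI : Module.Free (v.adicCompletion ℚ) K₀ := Module.Free.of_divisionRing _ _
  have hrk : Module.finrank K₀ L₀ = p ^ w := by
    have h := Module.finrank_mul_finrank (v.adicCompletion ℚ) K₀ L₀
    rw [hrkK, hrkL, pow_add] at h
    exact Nat.eq_of_mul_eq_mul_left (pow_pos hp.out.pos m) h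
  -- `Gal(L₀/K₀)` is cyclic (it embeds in the cyclic `Gal(L₀/ℚ_v)`)
  haveI : IsCyclic (L₀ ≃ₐ[K₀] L₀) := by
    let ρ : (L₀ ≃ₐ[K₀] L₀) →* (L₀ ≃ₐ[v.adicCompletion ℚ] L₀) :=
      { toFun := fun σ ↦ σ.restrictScalars (v.adicCompletion ℚ)
        map_one' := by ext; rfl
        map_mul' := fun a b ↦ by ext; rfl }
    exact isCyclic_of_injective ρ fun a b h ↦ AlgEquiv.ext fun x ↦ by
      have := congrArg (fun f : L₀ ≃ₐ[v.adicCompletion ℚ] L₀ ↦ f x) h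
      exact this
  -- the CLASS FIELD AXIOM for the layer `[K₀ˣ : N(L₀/K₀)] = p^w`
  have hidxKL : (Units.map (Algebra.norm K₀ : L₀ →* K₀)).range.index = p ^ w := by
    rw [normIndex_eq_finrank_of_isNonarchimedeanLocalField (v.adicCompletion ℚ) K₀ L₀, hrk]
  -- the three norm maps on units and transitivity
  set NK : K₀ˣ →* (v.adicCompletion ℚ)ˣ := Units.map (Algebra.norm (v.adicCompletion ℚ) : K₀ →* v.adicCompletion ℚ)
    with hNK
  set NL : L₀ˣ →* (v.adicCompletion ℚ)ˣ := Units.map (Algebra.norm (v.adicCompletion ℚ) : L₀ →* v.adicCompletion ℚ)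
    with hNL
  set NKL : L₀ˣ →* K₀ˣ := Units.map (Algebra.norm K₀ : L₀ →* K₀) with hNKL
  have htrans : ∀ z : L₀ˣ, NK (NKL z) = NL z := fun z ↦ Units.ext (by
    simp only [hNK, hNL, hNKL, Units.coe_map]
    exact Algebra.norm_norm)
  have hmapB : NKL.range.map NK = NL.range := by
    ext y
    constructor
    · rintro ⟨b, ⟨z, rfl⟩, rfl⟩
      exact ⟨z, (htrans z).symm⟩
    · rintro ⟨z, rfl⟩
      exact ⟨NKL z, ⟨z, rfl⟩, htrans z⟩
  -- the transfer by counting: `ker NK ≤ N(L₀/K₀)`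
  have hkerle : NK.ker ≤ NKL.range := by
    have h1 := Subgroup.index_map (G := K₀ˣ) NKL.range NK
    rw [hmapB, hidxL, hidxK, pow_add, mul_comm] at h1
    -- `p^w * p^m = (B' ⊔ ker).index * p^m`
    have h2 : (NKL.range ⊔ NK.ker).index = p ^ w :=
      (Nat.eq_of_mul_eq_mul_right (pow_pos hp.out.pos m) h1).symm
    have h3 : NKL.range = NKL.range ⊔ NK.ker :=
      subgroup_eq_of_le_of_index_eq (le_sup_left : NKL.range ≤ NKL.range ⊔ NK.ker) (by rw [hidxKL, h2])
        (by rw [h2]; exact pow_ne_zero _ hp.out.ne_zero)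
    rw [h3]
    exact le_sup_right
  -- `q ∈ K₀ˣ` and `NK q = q^{p^m}`
  have hqK : algebraMap (v.adicCompletion ℚ) (AlgebraicClosure (v.adicCompletion ℚ)) (q : v.adicCompletion ℚ) ∈ K₀ :=
    memK.mpr fun h _ ↦ AlgEquiv.commutes (absoluteGaloisGroup.toAlgEquiv _ h) _
  set y : K₀ˣ := Units.mk0 (algebraMap (v.adicCompletion ℚ) K₀ (q : v.adicCompletion ℚ))
    (by rw [ne_eq, map_eq_zero_iff _ (algebraMap (v.adicCompletion ℚ) K₀).injective]; exact q.ne_zero) with hy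
  have hNKy : NK y = q ^ p ^ m := Units.ext (by
    simp only [hNK, hy, Units.coe_map, Units.val_mk0, Units.val_pow_eq_pow_val]
    rw [Algebra.norm_algebraMap, hrkK])
  -- hence `y ∈ N(L₀/K₀)`
  have hyB : y ∈ NKL.range := by
    have h1 : NK y ∈ NKL.range.map NK := by rw [hmapB, hNKy]; exact hmem
    obtain ⟨b, hb, hNb⟩ := h1
    have h2 : y * b⁻¹ ∈ NK.ker := by rw [MonoidHom.mem_ker, map_mul, map_inv, ← hNb, mul_inv_cancel]
    have h3 := hkerle h2
    have h4 : y = (y * b⁻¹) * b := by rw [inv_mul_cancel_right]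
    rw [h4]
    exact mul_mem h3 hb
  obtain ⟨z, hz⟩ := hyB
  -- `Gal(L₀/K₀) = {g^i|}_{i<p^w}` and the relative orbit product
  have hgiK : ∀ (i : ℕ) (k : K₀), (g ^ i) • (k : AlgebraicClosure (v.adicCompletion ℚ)) = k := fun i k ↦
    memK.mp k.2 (g ^ i) (Hm.pow_mem hgm i)
  haveI : Hmw.Normal := by rw [hHmw, localSubgroup_eq_comap]; exact Subgroup.Normal.comap inferInstance _
  let r : ℕ → (L₀ ≃ₐ[v.adicCompletion ℚ] L₀) := fun i ↦
    (absoluteGaloisGroup.toAlgEquiv (v.adicCompletion ℚ) (g ^ i)).restrictNormal L₀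
  have hr : ∀ (i : ℕ) (x : L₀), ((r i x : L₀) : AlgebraicClosure (v.adicCompletion ℚ)) =
      (g ^ i) • (x : AlgebraicClosure (v.adicCompletion ℚ)) := fun i x ↦
    AlgEquiv.restrictNormal_commutes _ L₀ x
  let τ : ℕ → (L₀ ≃ₐ[K₀] L₀) := fun i ↦ AlgEquiv.ofRingEquiv (f := (r i).toRingEquiv) (fun k ↦ by
    apply Subtype.ext
    change ((r i (algebraMap K₀ L₀ k) : L₀) : AlgebraicClosure (v.adicCompletion ℚ)) =
      ((algebraMap K₀ L₀ k : L₀) : AlgebraicClosure (v.adicCompletion ℚ))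
    rw [hr, LocalWeilDatum.towerAlgebra_algebraMap_apply]
    exact hgiK i k)
  have hτ : ∀ (i : ℕ) (x : L₀), ((τ i x : L₀) : AlgebraicClosure (v.adicCompletion ℚ)) =
      (g ^ i) • (x : AlgebraicClosure (v.adicCompletion ℚ)) := fun i x ↦ by exact hr i x
  -- injectivity of `i ↦ τ i` on `i < p^w`: `g^i`, `g^j` agreeing on `L₀` forces `g^{j−i} ∈ fixingSubgroup L₀ = H_{m+w}`
  have key : ∀ i j : Fin (p ^ w), (∀ x : L₀, (g ^ (i : ℕ)) • (x : AlgebraicClosure (v.adicCompletion ℚ)) =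
      (g ^ (j : ℕ)) • (x : AlgebraicClosure (v.adicCompletion ℚ))) → (i : ℕ) ≤ j → i = j := by
    intro i j hagree hle
    have hmem : g ^ ((j : ℕ) - i) ∈ Hmw := by
      refine (keyfix _).mp ((IntermediateField.mem_fixingSubgroup_iff L₀ _).mpr fun x hx ↦ ?_)
      change (g ^ ((j : ℕ) - i)) • x = x
      have h1 := hagree ⟨x, hx⟩
      have h2 : g ^ (j : ℕ) = g ^ (i : ℕ) * g ^ ((j : ℕ) - i) := by rw [← pow_add, Nat.add_sub_cancel' hle]
      rw [h2, mul_smul] at h1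
      exact (smul_left_cancel_iff (g ^ (i : ℕ))).mp h1.symm
    rw [hpowmem] at hmem
    have hlt : (j : ℕ) - i < p ^ w := by omega
    have h0 : (j : ℕ) - i = 0 := Nat.eq_zero_of_dvd_of_lt hmem hlt
    exact Fin.ext (by omega)
  have hinj : Function.Injective (fun i : Fin (p ^ w) ↦ τ i) := by
    intro i j hij
    have hagree : ∀ x : L₀, (g ^ (i : ℕ)) • (x : AlgebraicClosure (v.adicCompletion ℚ)) =
        (g ^ (j : ℕ)) • (x : AlgebraicClosure (v.adicCompletion ℚ)) := fun x ↦ by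
      rw [← hτ, ← hτ]
      exact congrArg (fun σ : L₀ ≃ₐ[K₀] L₀ ↦ ((σ x : L₀) : AlgebraicClosure (v.adicCompletion ℚ))) hij
    rcases le_total (i : ℕ) j with hle | hle
    · exact key i j hagree hle
    · exact (key j i (fun x ↦ (hagree x).symm) hle).symm
  have hcardGal : Fintype.card (L₀ ≃ₐ[K₀] L₀) = p ^ w := by
    rw [← Nat.card_eq_fintype_card, IsGalois.card_aut_eq_finrank, hrk]
  have hbij : Function.Bijective (fun i : Fin (p ^ w) ↦ τ i) := by
    rw [Fintype.bijective_iff_injective_and_card]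
    exact ⟨hinj, by rw [Fintype.card_fin, hcardGal]⟩
  have hnormz : ((Algebra.norm K₀ (z : L₀) : K₀) : AlgebraicClosure (v.adicCompletion ℚ)) =
      ∏ i ∈ Finset.range (p ^ w), (g ^ i) • ((z : L₀) : AlgebraicClosure (v.adicCompletion ℚ)) := by
    have hprod := Algebra.norm_eq_prod_automorphisms K₀ (z : L₀)
    have h1 : ((Algebra.norm K₀ (z : L₀) : K₀) : AlgebraicClosure (v.adicCompletion ℚ)) =
        ((algebraMap K₀ L₀ (Algebra.norm K₀ (z : L₀)) : L₀) : AlgebraicClosure (v.adicCompletion ℚ)) :=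
      (LocalWeilDatum.towerAlgebra_algebraMap_apply hKL _).symm
    rw [h1, hprod, IntermediateField.coe_prod,
      ← hbij.prod_comp (fun σ : L₀ ≃ₐ[K₀] L₀ ↦ ((σ (z : L₀) : L₀) : AlgebraicClosure (v.adicCompletion ℚ))),
      ← Fin.prod_univ_eq_prod_range (fun i ↦ (g ^ i) • ((z : L₀) : AlgebraicClosure (v.adicCompletion ℚ))) (p ^ w)]
    exact Finset.prod_congr rfl fun i _ ↦ hτ i (z : L₀)
  -- the witness
  have hz0 : ((z : L₀) : AlgebraicClosure (v.adicCompletion ℚ)) ≠ 0 := fun h0 ↦ z.ne_zero (Subtype.ext h0)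
  refine ⟨Units.mk0 _ hz0, fun h hh ↦ ?_, ?_⟩
  · rw [Units.val_mk0]
    exact memL.mp (z : L₀).2 h hh
  · rw [Units.val_mk0, ← hnormz]
    have h1 := congrArg (fun u : K₀ˣ ↦ ((u : K₀) : AlgebraicClosure (v.adicCompletion ℚ))) hz
    simp only [hNKL, Units.coe_map, hy, Units.val_mk0] at h1
    rw [h1]
    rfl

end Summit.BirchSwinnertonDyer.BirchSwinnertonDyer.Theorems.MultTowerSplitExact

end
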